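import Mathlib
import HarnessLib

/-!
# Parity games on finite arenas: positional plays, lasso cycles, `EvenWinsPositional`

A (vertex-coloured, max-)parity game on a finite vertex type `V` is given by plain data

* an owner map `o : V → Bool` (`true` = the player **Even**, also called Eve / Max;
  `false` = **Odd** / Adam / Min),
* a priority map `p : V → ℕ`,
* an edge relation `E : V → V → Prop`.

The players move a token along edges, the owner of the current vertex choosing the edge; Even
wins an infinite play iff the largest priority seen infinitely often is even
([cite: FijalkowEtAl2023GamesOnGraphs, Ch. 1 §3 "Objectives" (parity) and Ch. 2 §3]; originally
Emerson–Jutla 1991, Mostowski 1991; Zielonka 1998).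

## Contents

* `positionalPlay o σ τ` — the successor map `w ↦ if o w then σ w else τ w` of the play in which
  both players use positional (memoryless) strategies `σ τ : V → V`; the play from `v` is
  `t ↦ (positionalPlay o σ τ)^[t] v` and is ultimately periodic ("a lasso").
* `infinitelyOften ρ` — the (finite, nonempty) set of vertices a play `ρ : ℕ → V` visits
  infinitely often; `lassoCycle o σ τ v` — that set for the positional play from `v`, i.e. the
  cycle of the lasso.
* `ParityGame.EvenWinsPositional o p E v` / `ParityGame.OddWinsPositional o p E v` — "there is
  a legal positional strategy of the player that beats every legal positional strategy of the
  opponent from `v`", the outcome of a pair of positional strategies being the parity of the top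
  priority on the lasso cycle. This is the predicate INLINED by route PneNP/PositionalGames
  (`Summit.PneNP.PneNP.Theses.PositionalGames`), see `ParityGame.evenWinsPositional_iff`.
* `ParityGame.edgeOfBits o x` — the route's monotone input encoding of the edge relation by bits
  `x : V × V → Bool` (bit `(u, w)` means "edge present" at Even vertices and "edge absent" at Odd
  vertices); `ParityGame.winFn o p v` is the resulting Boolean function,
  `ParityGame.winFn_eq_fin` rewrites it (at `V = Fin n`) to the literal term of the route — the
  four route decls `ParityMonotone{Superpoly,QuasipolyUpper,Poly,QuasipolyLower}` restate over
  `winFn` by `simp only [winFn_eq_fin]; exact Iff.rfl` (checked) — and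
  `ParityGame.winFn_monotone` proves it is monotone.
* Strategies with memory (`List V → V → V`: history, most recent first, and current vertex ↦
  chosen successor), the play `play o σ τ v`, and `ParityGame.EvenWins` / `ParityGame.OddWins`
  (winning with arbitrary strategies).
* The named fact `ParityGame.PositionalDeterminacy` (parity games on finite arenas without dead
  ends are uniformly positionally determined; [cite: FijalkowEtAl2023GamesOnGraphs, Ch. 2 §3,
  Thm "Positional determinacy and complexity of parity games"]; originally Emerson–Jutla 1991,
  Mostowski 1991, Zielonka 1998) and its PROVED consequences: from every vertex exactly one
  player wins positionally, and positional winning coincides with winning under arbitrary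
  strategies (`ParityGame.PositionalDeterminacy.evenWins_iff_evenWinsPositional`, …).

## Design choices

* Legality of a strategy is GLOBAL (`∀ u, o u = true → E u (σ u)`), exactly as in the route: if
  some Even vertex has no outgoing edge then no legal Even strategy exists and
  `EvenWinsPositional` is false everywhere; if some Odd vertex has no outgoing edge the inner `∀ τ`
  is vacuous. On arenas without dead ends (`∀ u, ∃ w, E u w`, the standing assumption of the
  sources) these artefacts disappear; this is the "NoEvenDeadEnd ∧ (SomeOddDeadEnd ∨ W)"
  remark of the route.
* Decidability instances are found under `open scoped Classical`, as in the route file, so that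
  `winFn_eq_fin` is a syntactic match for the inlined term (instance terms included).
* Everything is stated for an arbitrary `Fintype V`; the route uses `V = Fin n`.

## Not here

Attractors, Zielonka's recursion and a proof of positional determinacy (a named fact for now);
progress measures / universal trees (Jurdziński 2000, Jurdziński–Lazić 2017, CDFJLP 2019); mean-
payoff games (sibling file, same positional-play layer).
-/

namespace Literature.Combinatorics.Games

open Filter

open scoped Classical

universe u

variable {V : Type u}

/-! ## Positional plays and the lasso cycle -/

/-- One step of the play when both players move positionally: at a vertex `w` with
`o w = true` (owned by Even / Max) the token moves to `σ w`, otherwise to `τ w`. The play from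
`v` under `(σ, τ)` is `t ↦ (positionalPlay o σ τ)^[t] v`. [folklore] -/
def positionalPlay (o : V → Bool) (σ τ : V → V) : V → V :=
  fun w => if o w = true then σ w else τ w

/-- Unfolding `positionalPlay`. [folklore] -/
theorem positionalPlay_apply (o : V → Bool) (σ τ : V → V) (w : V) :
    positionalPlay o σ τ w = if o w = true then σ w else τ w := rfl

/-- At an Even vertex the positional play follows `σ`. [folklore] -/
@[simp] theorem positionalPlay_of_eq_true {o : V → Bool} (σ τ : V → V) {w : V}
    (h : o w = true) : positionalPlay o σ τ w = σ w := by
  simp [positionalPlay, h]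

/-- At an Odd vertex the positional play follows `τ`. [folklore] -/
@[simp] theorem positionalPlay_of_eq_false {o : V → Bool} (σ τ : V → V) {w : V}
    (h : o w = false) : positionalPlay o σ τ w = τ w := by
  simp [positionalPlay, h]

/-- The set of vertices that a play `ρ : ℕ → V` on a finite vertex type visits infinitely often
(`∃ᶠ t in atTop, ρ t = u`). [folklore] -/
noncomputable def infinitelyOften [Fintype V] (ρ : ℕ → V) : Finset V :=
  Finset.univ.filter fun u => ∃ᶠ t : ℕ in Filter.atTop, ρ t = u

/-- Membership in `infinitelyOften`. [folklore] -/
@[simp] theorem mem_infinitelyOften [Fintype V] {ρ : ℕ → V} {u : V} :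
    u ∈ infinitelyOften ρ ↔ ∃ᶠ t : ℕ in Filter.atTop, ρ t = u := by
  simp [infinitelyOften]

/-- Pigeonhole: on a finite vertex type every play visits some vertex infinitely often.
[folklore] -/
theorem infinitelyOften_nonempty [Fintype V] (ρ : ℕ → V) : (infinitelyOften ρ).Nonempty := by
  obtain ⟨u, hu⟩ := Finite.exists_infinite_fiber ρ
  refine ⟨u, mem_infinitelyOften.2 ?_⟩
  rw [Nat.frequently_atTop_iff_infinite]
  have h : (ρ ⁻¹' {u}).Infinite := Set.infinite_coe_iff.mp hu
  simpa [Set.preimage] using h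

/-- If `u` is visited infinitely often by the orbit `t ↦ f^[t] v` then so is `f u`. [folklore] -/
theorem frequently_iterate_succ_of_frequently {f : V → V} {v u : V}
    (h : ∃ᶠ t : ℕ in Filter.atTop, f^[t] v = u) : ∃ᶠ t : ℕ in Filter.atTop, f^[t] v = f u := by
  rw [Filter.frequently_atTop] at h ⊢
  intro a
  obtain ⟨b, hb, hbu⟩ := h a
  exact ⟨b + 1, by omega, by rw [Function.iterate_succ_apply', hbu]⟩

/-- **The lasso cycle.** For positional strategies `σ` (Even) and `τ` (Odd) the play from `v`,
`t ↦ (positionalPlay o σ τ)^[t] v`, is ultimately periodic; `lassoCycle o σ τ v` is the set of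
vertices it visits infinitely often, i.e. the vertex set of its cycle. Written literally as the
route PneNP/PositionalGames inlines it. [folklore] -/
noncomputable def lassoCycle [Fintype V] (o : V → Bool) (σ τ : V → V) (v : V) : Finset V :=
  Finset.univ.filter fun u => ∃ᶠ t : ℕ in Filter.atTop, (positionalPlay o σ τ)^[t] v = u

/-- `lassoCycle` is `infinitelyOften` of the positional play (definitional). [folklore] -/
theorem lassoCycle_eq_infinitelyOften [Fintype V] (o : V → Bool) (σ τ : V → V) (v : V) :
    lassoCycle o σ τ v = infinitelyOften (fun t => (positionalPlay o σ τ)^[t] v) := rfl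

/-- Membership in the lasso cycle. [folklore] -/
@[simp] theorem mem_lassoCycle [Fintype V] {o : V → Bool} {σ τ : V → V} {v u : V} :
    u ∈ lassoCycle o σ τ v ↔ ∃ᶠ t : ℕ in Filter.atTop, (positionalPlay o σ τ)^[t] v = u := by
  simp [lassoCycle]

/-- The lasso cycle is nonempty (so `Finset.sup` / averages over it are not junk). [folklore] -/
theorem lassoCycle_nonempty [Fintype V] (o : V → Bool) (σ τ : V → V) (v : V) :
    (lassoCycle o σ τ v).Nonempty :=
  infinitelyOften_nonempty _

/-- The lasso cycle is closed under the play map. [folklore] -/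
theorem positionalPlay_mem_lassoCycle [Fintype V] {o : V → Bool} {σ τ : V → V} {v u : V}
    (hu : u ∈ lassoCycle o σ τ v) : positionalPlay o σ τ u ∈ lassoCycle o σ τ v := by
  rw [mem_lassoCycle] at hu ⊢
  exact frequently_iterate_succ_of_frequently hu

/-! ## Strategies with memory and plays -/

/-- One step of a play under strategies with memory. A strategy of either player is a map
`List V → V → V`: from the history (previously visited vertices, most recent first) and the
current vertex to the chosen successor. The state of a play is (history, current vertex).
[cite: FijalkowEtAl2023GamesOnGraphs, Ch. 1 §1 "Strategies"] -/
def playStep (o : V → Bool) (σ τ : List V → V → V) (s : List V × V) : List V × V :=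
  (s.2 :: s.1, if o s.2 = true then σ s.1 s.2 else τ s.1 s.2)

/-- The state (history, current vertex) after `t` steps of the play from `v` under `(σ, τ)`.
[cite: FijalkowEtAl2023GamesOnGraphs, Ch. 1 §1 "Strategies"] -/
def playState (o : V → Bool) (σ τ : List V → V → V) (v : V) (t : ℕ) : List V × V :=
  (playStep o σ τ)^[t] ([], v)

/-- The unique play from `v` consistent with the strategies `σ` (Even) and `τ` (Odd)
(`π^v_{σ,τ}` of the source). [cite: FijalkowEtAl2023GamesOnGraphs, Ch. 1 §1 "Strategies"] -/
def play (o : V → Bool) (σ τ : List V → V → V) (v : V) : ℕ → V :=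
  fun t => (playState o σ τ v t).2

/-- The history (vertices visited before time `t`, most recent first) of the play.
[cite: FijalkowEtAl2023GamesOnGraphs, Ch. 1 §1 "Strategies"] -/
def playHist (o : V → Bool) (σ τ : List V → V → V) (v : V) : ℕ → List V :=
  fun t => (playState o σ τ v t).1

/-- The play starts at `v`. [folklore] -/
@[simp] theorem play_zero (o : V → Bool) (σ τ : List V → V → V) (v : V) : play o σ τ v 0 = v :=
  rfl

/-- The history is initially empty. [folklore] -/
@[simp] theorem playHist_zero (o : V → Bool) (σ τ : List V → V → V) (v : V) :
    playHist o σ τ v 0 = [] := rfl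

/-- One step of the play: the owner of the current vertex moves. [folklore] -/
theorem play_succ (o : V → Bool) (σ τ : List V → V → V) (v : V) (t : ℕ) :
    play o σ τ v (t + 1) =
      if o (play o σ τ v t) = true then σ (playHist o σ τ v t) (play o σ τ v t)
      else τ (playHist o σ τ v t) (play o σ τ v t) := by
  simp only [play, playHist, playState, Function.iterate_succ_apply']
  rfl

/-- One step of the history. [folklore] -/
theorem playHist_succ (o : V → Bool) (σ τ : List V → V → V) (v : V) (t : ℕ) :
    playHist o σ τ v (t + 1) = play o σ τ v t :: playHist o σ τ v t := by
  simp only [play, playHist, playState, Function.iterate_succ_apply']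
  rfl

/-- A positional strategy viewed as a strategy with memory (it ignores the history).
[folklore] -/
def ofPositional (σ : V → V) : List V → V → V := fun _ u => σ u

/-- Unfolding `ofPositional`. [folklore] -/
@[simp] theorem ofPositional_apply (σ : V → V) (h : List V) (u : V) : ofPositional σ h u = σ u :=
  rfl

/-- Under two positional strategies the play is the orbit of `positionalPlay`. [folklore] -/
theorem play_ofPositional (o : V → Bool) (σ τ : V → V) (v : V) (t : ℕ) :
    play o (ofPositional σ) (ofPositional τ) v t = (positionalPlay o σ τ)^[t] v := by
  induction t with
  | zero => rfl
  | succ t ih =>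
    rw [play_succ, Function.iterate_succ_apply', ← ih]
    rfl

/-- Hence the vertices visited infinitely often are the lasso cycle. [folklore] -/
theorem infinitelyOften_play_ofPositional [Fintype V] (o : V → Bool) (σ τ : V → V) (v : V) :
    infinitelyOften (play o (ofPositional σ) (ofPositional τ) v) = lassoCycle o σ τ v := by
  rw [lassoCycle_eq_infinitelyOften]
  congr 1
  funext t
  exact play_ofPositional o σ τ v t

/-! ## Parity games -/

namespace ParityGame

/-- **Input encoding of route PneNP/PositionalGames.** The edge relation determined by the bits
`x : V × V → Bool`: at a vertex `u` of Even the edge `u → w` is present iff `x (u, w) = true`, at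
a vertex of Odd iff `x (u, w) = false` (Odd-edge bits are complemented), i.e.
`E u w := (x (u, w) = o u)`. This makes winning monotone in `x` (`winFn_monotone` below).
[folklore] -/
def edgeOfBits (o : V → Bool) (x : V × V → Bool) : V → V → Prop := fun u w => x (u, w) = o u

/-- Unfolding `edgeOfBits`. [folklore] -/
@[simp] theorem edgeOfBits_apply (o : V → Bool) (x : V × V → Bool) (u w : V) :
    edgeOfBits o x u w ↔ x (u, w) = o u := Iff.rfl

variable [Fintype V]

/-- **Even wins the parity game `(o, p, E)` positionally from `v`:** there is a positional
strategy `σ` of Even, legal at every Even vertex (`o u = true → E u (σ u)`), such that for every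
positional strategy `τ` of Odd legal at every Odd vertex, the largest priority on the lasso cycle
of the play from `v` is even. This is literally the predicate inlined by the route
PneNP/PositionalGames (`evenWinsPositional_iff`); on finite arenas without dead ends it is the
winning region of Even (`PositionalDeterminacy.evenWins_iff_evenWinsPositional`).
[cite: FijalkowEtAl2023GamesOnGraphs, Ch. 1 §5 "Memory" (positional strategies) and Ch. 2 §3] -/
def EvenWinsPositional (o : V → Bool) (p : V → ℕ) (E : V → V → Prop) (v : V) : Prop :=
  ∃ σ : V → V, (∀ u, o u = true → E u (σ u)) ∧
    ∀ τ : V → V, (∀ u, o u = false → E u (τ u)) → Even ((lassoCycle o σ τ v).sup p)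

/-- **Odd wins positionally from `v`:** the dual of `EvenWinsPositional` — a legal positional
`τ` such that against every legal positional `σ` the top priority on the lasso cycle is odd.
[cite: FijalkowEtAl2023GamesOnGraphs, Ch. 1 §5 "Memory" (positional strategies) and Ch. 2 §3] -/
def OddWinsPositional (o : V → Bool) (p : V → ℕ) (E : V → V → Prop) (v : V) : Prop :=
  ∃ τ : V → V, (∀ u, o u = false → E u (τ u)) ∧
    ∀ σ : V → V, (∀ u, o u = true → E u (σ u)) → Odd ((lassoCycle o σ τ v).sup p)

/-- `EvenWinsPositional` unfolded to the shape inlined by route PneNP/PositionalGames (with a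
general edge relation `E`); definitional. [folklore] -/
theorem evenWinsPositional_iff (o : V → Bool) (p : V → ℕ) (E : V → V → Prop) (v : V) :
    EvenWinsPositional o p E v ↔
      ∃ σ : V → V, (∀ u, o u = true → E u (σ u)) ∧ ∀ τ : V → V,
        (∀ u, o u = false → E u (τ u)) →
          Even ((Finset.univ.filter fun u : V => ∃ᶠ t : ℕ in Filter.atTop,
            (fun w : V => if o w = true then σ w else τ w)^[t] v = u).sup p) :=
  Iff.rfl

/-- `OddWinsPositional` unfolded; definitional. [folklore] -/
theorem oddWinsPositional_iff (o : V → Bool) (p : V → ℕ) (E : V → V → Prop) (v : V) :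
    OddWinsPositional o p E v ↔
      ∃ τ : V → V, (∀ u, o u = false → E u (τ u)) ∧ ∀ σ : V → V,
        (∀ u, o u = true → E u (σ u)) →
          Odd ((Finset.univ.filter fun u : V => ∃ᶠ t : ℕ in Filter.atTop,
            (fun w : V => if o w = true then σ w else τ w)^[t] v = u).sup p) :=
  Iff.rfl

/-- The two players cannot both win positionally from the same vertex (confront the two
strategies). [cite: FijalkowEtAl2023GamesOnGraphs, Ch. 1 §1, Fact "Winning regions are
disjoint"] -/
theorem not_evenWinsPositional_and_oddWinsPositional (o : V → Bool) (p : V → ℕ)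
    (E : V → V → Prop) (v : V) : ¬ (EvenWinsPositional o p E v ∧ OddWinsPositional o p E v) := by
  rintro ⟨⟨σ, hσ, hσw⟩, ⟨τ, hτ, hτw⟩⟩
  exact (Nat.not_even_iff_odd.mpr (hτw σ hσ)) (hσw τ hτ)

/-- Enlarging the moves of Even and shrinking the moves of Odd preserves positional winning of
Even. [folklore] -/
theorem EvenWinsPositional.mono {o : V → Bool} {p : V → ℕ} {E E' : V → V → Prop} {v : V}
    (h : EvenWinsPositional o p E v) (hEven : ∀ u w, o u = true → E u w → E' u w)
    (hOdd : ∀ u w, o u = false → E' u w → E u w) : EvenWinsPositional o p E' v := by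
  obtain ⟨σ, hσ, hwin⟩ := h
  exact ⟨σ, fun u hu => hEven u _ hu (hσ u hu), fun τ hτ => hwin τ fun u hu => hOdd u _ hu (hτ u hu)⟩

/-! ### The monotone input encoding of the route -/

/-- **Bridge to the route.** `EvenWinsPositional` for the encoded edge relation is, up to
rewriting `o u` by `true`/`false` under the respective hypotheses, LITERALLY the term inlined in
`Summit.PneNP.PneNP.Theses.PositionalGames.ParityMonotoneSuperpoly` (and items 1297–1299).
[folklore] -/
theorem evenWinsPositional_edgeOfBits_iff (o : V → Bool) (p : V → ℕ) (v : V)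
    (x : V × V → Bool) :
    EvenWinsPositional o p (edgeOfBits o x) v ↔
      ∃ σ : V → V, (∀ u, o u = true → x (u, σ u) = true) ∧ ∀ τ : V → V,
        (∀ u, o u = false → x (u, τ u) = false) →
          Even ((Finset.univ.filter fun u : V => ∃ᶠ t : ℕ in Filter.atTop,
            (fun w : V => if o w = true then σ w else τ w)^[t] v = u).sup p) := by
  unfold EvenWinsPositional edgeOfBits lassoCycle positionalPlay
  refine exists_congr fun σ => and_congr ?_ (forall_congr' fun τ => imp_congr ?_ Iff.rfl)
  · exact forall_congr' fun u => imp_congr_right fun hu => by rw [hu]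
  · exact forall_congr' fun u => imp_congr_right fun hu => by rw [hu]

/-- **WIN**, the Boolean function of the edge bits computed by the route's circuits:
`x ↦ [Even wins positionally from v in the game encoded by x]`. [folklore] -/
noncomputable def winFn (o : V → Bool) (p : V → ℕ) (v : V) : (V × V → Bool) → Bool :=
  fun x => decide (EvenWinsPositional o p (edgeOfBits o x) v)

/-- Unfolding `winFn`. [folklore] -/
theorem winFn_apply (o : V → Bool) (p : V → ℕ) (v : V) (x : V × V → Bool) :
    winFn o p v x = decide (EvenWinsPositional o p (edgeOfBits o x) v) := rfl

/-- `winFn` is pointwise the `decide` of the route-shaped proposition (general vertex type; the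
`Decidable` instance on the right is whatever instance resolution finds here — for the SYNTACTIC
match with the route at `V = Fin n` use `winFn_eq_fin`). [folklore] -/
theorem winFn_eq (o : V → Bool) (p : V → ℕ) (v : V) :
    winFn o p v = fun x : V × V → Bool => decide (∃ σ : V → V,
      (∀ u, o u = true → x (u, σ u) = true) ∧ ∀ τ : V → V,
        (∀ u, o u = false → x (u, τ u) = false) →
          Even ((Finset.univ.filter fun u : V => ∃ᶠ t : ℕ in Filter.atTop,
            (fun w : V => if o w = true then σ w else τ w)^[t] v = u).sup p)) := by
  funext x
  exact (decide_eq_decide).2 (evenWinsPositional_edgeOfBits_iff o p v x)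

/-- **`winFn` is the route's function, literally (`V = Fin n`).** The right-hand side is the
lambda that `Summit.PneNP.PneNP.Theses.PositionalGames.ParityMonotoneSuperpoly` /
`ParityMonotoneQuasipolyLower` / `ParityMonotoneQuasipolyUpper` / `ParityMonotonePoly` feed to
`circuitSizeOver`, elaborated here exactly as there (same `open scoped Classical` context, hence
the same `Decidable` instance terms: `Fintype.decidableExistsFintype`, `Nat.decidableForallFin`,
`Classical.propDecidable` for `∃ᶠ`), so those items restate over `winFn` by
`simp only [winFn_eq_fin]; exact Iff.rfl` (checked in the planner-facing scratch file).
[folklore] -/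
theorem winFn_eq_fin (n : ℕ) (o : Fin n → Bool) (p : Fin n → ℕ) (v : Fin n) :
    winFn o p v = fun x : Fin n × Fin n → Bool => decide (∃ σ : Fin n → Fin n,
      (∀ u, o u = true → x (u, σ u) = true) ∧ ∀ τ : Fin n → Fin n,
        (∀ u, o u = false → x (u, τ u) = false) →
          Even ((Finset.univ.filter fun u : Fin n => ∃ᶠ t : ℕ in Filter.atTop,
            (fun w : Fin n => if o w = true then σ w else τ w)^[t] v = u).sup p)) := by
  funext x
  exact (decide_eq_decide).2 (evenWinsPositional_edgeOfBits_iff o p v x)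

/-- Raising bits helps Even: more Even edges, fewer Odd edges. [folklore] -/
theorem EvenWinsPositional.mono_bits {o : V → Bool} {p : V → ℕ} {v : V} {x y : V × V → Bool}
    (hxy : x ≤ y) (h : EvenWinsPositional o p (edgeOfBits o x) v) :
    EvenWinsPositional o p (edgeOfBits o y) v := by
  refine h.mono (fun u w hu he => ?_) (fun u w hu he => ?_)
  · simp only [edgeOfBits, hu] at he ⊢
    exact Bool.le_iff_imp.1 (hxy (u, w)) he
  · simp only [edgeOfBits, hu] at he ⊢
    have h2 := Bool.le_iff_imp.1 (hxy (u, w))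
    cases hx : x (u, w) with
    | false => rfl
    | true => exact ((Bool.eq_false_iff.mp he) (h2 hx)).elim

/-- **Monotonicity of WIN** in the edge bits (Even-edge bits positive, Odd-edge bits
complemented): the function the route bounds by monotone circuits is indeed monotone.
[folklore] -/
theorem winFn_monotone (o : V → Bool) (p : V → ℕ) (v : V) : Monotone (winFn o p v) := by
  intro x y hxy
  rw [Bool.le_iff_imp]
  simp only [winFn, decide_eq_true_eq]
  exact fun h => h.mono_bits hxy

/-! ### Winning with arbitrary strategies; positional determinacy -/

/-- **Even wins from `v` (arbitrary strategies):** Even has a strategy with memory, legal at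
every history, such that against every legal strategy with memory of Odd the largest priority
visited infinitely often by the play from `v` is even. (Legality is required at all histories;
on arenas without dead ends this is equivalent to the textbook notion, strategies being total
maps from finite plays to outgoing edges.) [cite: FijalkowEtAl2023GamesOnGraphs, Ch. 1 §1
"Winning in qualitative games" and §3 (parity objective)] -/
def EvenWins (o : V → Bool) (p : V → ℕ) (E : V → V → Prop) (v : V) : Prop :=
  ∃ σ : List V → V → V, (∀ h u, o u = true → E u (σ h u)) ∧
    ∀ τ : List V → V → V, (∀ h u, o u = false → E u (τ h u)) →
      Even ((infinitelyOften (play o σ τ v)).sup p)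

/-- **Odd wins from `v` (arbitrary strategies)**, the dual of `EvenWins`.
[cite: FijalkowEtAl2023GamesOnGraphs, Ch. 1 §1 "Winning in qualitative games" and §3] -/
def OddWins (o : V → Bool) (p : V → ℕ) (E : V → V → Prop) (v : V) : Prop :=
  ∃ τ : List V → V → V, (∀ h u, o u = false → E u (τ h u)) ∧
    ∀ σ : List V → V → V, (∀ h u, o u = true → E u (σ h u)) →
      Odd ((infinitelyOften (play o σ τ v)).sup p)

/-- Winning regions are disjoint. [cite: FijalkowEtAl2023GamesOnGraphs, Ch. 1 §1, Fact
"Winning regions are disjoint"] -/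
theorem not_evenWins_and_oddWins (o : V → Bool) (p : V → ℕ) (E : V → V → Prop) (v : V) :
    ¬ (EvenWins o p E v ∧ OddWins o p E v) := by
  rintro ⟨⟨σ, hσ, hσw⟩, ⟨τ, hτ, hτw⟩⟩
  exact (Nat.not_even_iff_odd.mpr (hτw σ hσ)) (hσw τ hτ)

end ParityGame

/-- **Positional (memoryless) determinacy of parity games on finite arenas** (named fact).
For every parity game on a finite vertex type in which every vertex has an outgoing edge, there
is a pair of legal POSITIONAL strategies `σ` (Even) and `τ` (Odd) such that from every vertex
`v` either `σ` wins against every legal strategy with memory of Odd, or `τ` wins against every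
legal strategy with memory of Even — "parity objectives are uniformly positionally determined"
together with determinacy (`W_Eve ∪ W_Adam = V`, which the source's proof via the
McNaughton–Zielonka recursion yields: "for every vertex either of the two players has a
positional winning strategy"). The source colours EDGES with priorities in `[1, d]` and lets the
largest priority seen infinitely often decide; vertex priorities `p : V → ℕ` are the special
case `col (u → w) := p u` ("vertex labelling ⊆ edge labelling", Ch. 1 §1), and only the order
and parity of priorities matter. Originally: Emerson–Jutla (FOCS 1991, "memoryless
determinacy"), Mostowski 1991, McNaughton 1993 (finite graphs), Zielonka (TCS 200, 1998); a
short proof for finite arenas: Björklund–Sandberg–Vorobyov, TCS 310 (2004).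
[cite: FijalkowEtAl2023GamesOnGraphs, Ch. 2 §3, Thm "Positional determinacy and complexity of
parity games" with Ch. 1 §5 (definitions of (uniformly) positionally determined)] -/
def ParityGame.PositionalDeterminacy : Prop :=
  ∀ (V : Type u) [Fintype V] (o : V → Bool) (p : V → ℕ) (E : V → V → Prop),
    (∀ u, ∃ w, E u w) →
      ∃ σ τ : V → V, (∀ u, o u = true → E u (σ u)) ∧ (∀ u, o u = false → E u (τ u)) ∧
        ∀ v : V,
          (∀ τ' : List V → V → V, (∀ h u, o u = false → E u (τ' h u)) →
              Even ((infinitelyOften (play o (ofPositional σ) τ' v)).sup p)) ∨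
          (∀ σ' : List V → V → V, (∀ h u, o u = true → E u (σ' h u)) →
              Odd ((infinitelyOften (play o σ' (ofPositional τ) v)).sup p))

namespace ParityGame

variable [Fintype V]

/-- **Consequence 1: from every vertex of a dead-end-free finite arena one of the players wins
positionally** (in the `∃ positional ∀ positional` sense of the route).
[cite: FijalkowEtAl2023GamesOnGraphs, Ch. 2 §3, Thm "Positional determinacy and complexity of
parity games"] -/
theorem PositionalDeterminacy.evenWinsPositional_or_oddWinsPositional
    (hdet : PositionalDeterminacy.{u}) (o : V → Bool) (p : V → ℕ) (E : V → V → Prop)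
    (hE : ∀ u, ∃ w, E u w) (v : V) :
    EvenWinsPositional o p E v ∨ OddWinsPositional o p E v := by
  obtain ⟨σ, τ, hσ, hτ, h⟩ := hdet V o p E hE
  rcases h v with hv | hv
  · refine Or.inl ⟨σ, hσ, fun τ' hτ' => ?_⟩
    have h1 := hv (ofPositional τ') (fun _ u hu => hτ' u hu)
    rwa [infinitelyOften_play_ofPositional] at h1
  · refine Or.inr ⟨τ, hτ, fun σ' hσ' => ?_⟩
    have h1 := hv (ofPositional σ') (fun _ u hu => hσ' u hu)
    rwa [infinitelyOften_play_ofPositional] at h1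

/-- **Consequence 2: exactly one player wins positionally from each vertex.**
[cite: FijalkowEtAl2023GamesOnGraphs, Ch. 2 §3, Thm "Positional determinacy and complexity of
parity games"] -/
theorem PositionalDeterminacy.evenWinsPositional_iff_not_oddWinsPositional
    (hdet : PositionalDeterminacy.{u}) (o : V → Bool) (p : V → ℕ) (E : V → V → Prop)
    (hE : ∀ u, ∃ w, E u w) (v : V) :
    EvenWinsPositional o p E v ↔ ¬ OddWinsPositional o p E v :=
  ⟨fun h h' => not_evenWinsPositional_and_oddWinsPositional o p E v ⟨h, h'⟩,
    fun h => (hdet.evenWinsPositional_or_oddWinsPositional o p E hE v).resolve_right h⟩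

/-- **Consequence 3: positional winning is winning.** On a dead-end-free finite arena Even has
a winning strategy with memory from `v` iff `EvenWinsPositional o p E v`.
[cite: FijalkowEtAl2023GamesOnGraphs, Ch. 2 §3, Thm "Positional determinacy and complexity of
parity games"] -/
theorem PositionalDeterminacy.evenWins_iff_evenWinsPositional
    (hdet : PositionalDeterminacy.{u}) (o : V → Bool) (p : V → ℕ) (E : V → V → Prop)
    (hE : ∀ u, ∃ w, E u w) (v : V) :
    EvenWins o p E v ↔ EvenWinsPositional o p E v := by
  obtain ⟨σ, τ, hσ, hτ, h⟩ := hdet V o p E hE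
  constructor
  · rintro ⟨σ', hσ', hwin⟩
    rcases h v with hv | hv
    · refine ⟨σ, hσ, fun τ' hτ' => ?_⟩
      have h1 := hv (ofPositional τ') (fun _ u hu => hτ' u hu)
      rwa [infinitelyOften_play_ofPositional] at h1
    · exact absurd (hwin (ofPositional τ) (fun _ u hu => hτ u hu))
        (Nat.not_even_iff_odd.mpr (hv σ' hσ'))
  · rintro ⟨σ', hσ', hwin⟩
    rcases h v with hv | hv
    · exact ⟨ofPositional σ, fun _ u hu => hσ u hu, hv⟩
    · have h1 := hv (ofPositional σ') (fun _ u hu => hσ' u hu)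
      rw [infinitelyOften_play_ofPositional] at h1
      exact absurd (hwin τ hτ) (Nat.not_even_iff_odd.mpr h1)

/-- **Consequence 3, dual: Odd has a winning strategy with memory from `v` iff
`OddWinsPositional o p E v`.** [cite: FijalkowEtAl2023GamesOnGraphs, Ch. 2 §3, Thm "Positional
determinacy and complexity of parity games"] -/
theorem PositionalDeterminacy.oddWins_iff_oddWinsPositional
    (hdet : PositionalDeterminacy.{u}) (o : V → Bool) (p : V → ℕ) (E : V → V → Prop)
    (hE : ∀ u, ∃ w, E u w) (v : V) :
    OddWins o p E v ↔ OddWinsPositional o p E v := by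
  obtain ⟨σ, τ, hσ, hτ, h⟩ := hdet V o p E hE
  constructor
  · rintro ⟨τ', hτ', hwin⟩
    rcases h v with hv | hv
    · exact absurd (hv τ' hτ')
        (Nat.not_even_iff_odd.mpr (hwin (ofPositional σ) (fun _ u hu => hσ u hu)))
    · refine ⟨τ, hτ, fun σ' hσ' => ?_⟩
      have h1 := hv (ofPositional σ') (fun _ u hu => hσ' u hu)
      rwa [infinitelyOften_play_ofPositional] at h1
  · rintro ⟨τ', hτ', hwin⟩
    rcases h v with hv | hv
    · have h1 := hv (ofPositional τ') (fun _ u hu => hτ' u hu)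
      rw [infinitelyOften_play_ofPositional] at h1
      exact absurd h1 (Nat.not_even_iff_odd.mpr (hwin σ hσ))
    · exact ⟨ofPositional τ, fun _ u hu => hτ u hu, hv⟩

/-- **Consequence 4: determinacy with arbitrary strategies** — from every vertex of a
dead-end-free finite arena exactly one of the players has a winning strategy.
[cite: FijalkowEtAl2023GamesOnGraphs, Ch. 2 §3, Thm "Positional determinacy and complexity of
parity games"] -/
theorem PositionalDeterminacy.evenWins_iff_not_oddWins
    (hdet : PositionalDeterminacy.{u}) (o : V → Bool) (p : V → ℕ) (E : V → V → Prop)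
    (hE : ∀ u, ∃ w, E u w) (v : V) :
    EvenWins o p E v ↔ ¬ OddWins o p E v := by
  rw [hdet.evenWins_iff_evenWinsPositional o p E hE, hdet.oddWins_iff_oddWinsPositional o p E hE]
  exact hdet.evenWinsPositional_iff_not_oddWinsPositional o p E hE v

end ParityGame

end Literature.Combinatorics.Games
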